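import Literature.NumberTheory.EllipticCurves.IwasawaAlgebraEisensteinQuotientTorsionProofs
import Mathlib.RingTheory.Localization.FractionRing
import Mathlib.RingTheory.Length
import HarnessLib

/-!
# Glue algebra for the DVR Kolyvagin bound: free rank-one modules (`len(H/Rκ₁) = len(R/r₁R)`) and the divisibility
# of `𝒟 = Frac(R)/R` (proofs file)

Topic `NumberTheory/EllipticCurves`. THEOREMS ONLY (Mathlib `Module.length`, `FractionRing`, submodule quotients); no
definition, no named fact, no instance, no `sorry`.

The conclusion of Howard's Thm. 1.6.1 (Compositio 140 (2004); tree typing `Howard2004.DVRSetting.Conclusion`, file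
`Howard2004/DVRKolyvaginBound.lean`) is phrased with a generator `x` of the free rank-one `R`-module `H¹_F(K,T)`
(`IsFreeRankOneOn … x`: `r • x = 0 → r = 0` and every element is `r • x`), with `𝒟 = Frac(R)/R` (`FracModR R`) and with
the length bound `len_R M ≤ len_R (R / r₁R)` for `κ₁ = r₁ • x` («with `x` the generator and `κ_1 = r₁ x`,
`len_R(H¹_F(K,T)/Rκ_1) = len_R(R/r₁R)`»). The witness interface of cell `pub/bsd-print-x9`
(`HeegnerMuPartStabilized.SpecWitness`, constructors `nonempty_specWitness_of_howardShape[_addEquiv]`) wants instead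
`e : H ≃ₗ[R] R`, `len M ≤ len (H ⧸ R∙κ₁)` and the divisibility of `𝒟`. This file is that dictionary:

* `exists_linearEquiv_of_free_rank_one` — a free rank-one module on `x` is `≃ₗ[R] R` with `x ↦ 1`;
* `length_quotient_span_singleton_eq_of_linearEquiv` — `len (H ⧸ R∙κ₁) = len (R ⧸ (e κ₁))` for `e : H ≃ₗ[R] R`;
* `length_quotient_span_smul_eq` — `len (H ⧸ R∙(r₁ • x)) = len (R ⧸ r₁R)` for `H` free rank one on `x`;
* `exists_smul_eq_fracMod_of_ne_zero` / `_of_mem_nonZeroDivisors` / `exists_nsmul_eq_fracMod` — `Frac(R)/R` is divisible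
  by every non-zero `r ∈ R` (domain `R`), in particular by every `n : ℕ` with `(n : R) ≠ 0`;
* `IwasawaAlgebra.exists_nsmul_eq_fracMod_quotient_X_pow_add_C` — for `S_m = Λ/(T^m + p)` (`m ≥ 1`, characteristic
  `0`): `Frac(S_m)/S_m` is divisible by every `n ≥ 1`.

Cell `pub/bsd-print-x9`, seat `bsd-line-x9-p1-w2` (g5), v9-plan STUB 4 «glue currency» of the shared μ-item on crux
stmt-BirchSwinnertonDyer-27077.

References: [Howard2004HeegnerKolyvagin] Thm. 1.6.1 (arXiv Thm. 2.6.1, p. 11 L23–28) and §1.6 (𝒟 = Φ/R).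
-/

noncomputable section

open scoped nonZeroDivisors

universe u v

namespace Literature.NumberTheory.EllipticCurves

/-! ## §1 Free rank-one modules -/

section FreeRankOne

variable {R : Type u} [CommRing R] {H : Type v} [AddCommGroup H] [Module R H]

/-- **A free rank-one module on `x` is isomorphic to `R` with `x ↦ 1`**: if `r • x = 0 → r = 0` and every element
is a multiple of `x`, then `r ↦ r • x` is an `R`-linear bijection `R ≃ H`. (Howard's «`H¹_F(K,T)` is a free rank-one
`R`-module», generator form ↔ `≃ₗ[R] R` form.) [cite: Howard2004HeegnerKolyvagin, Thm. 1.6.1 (arXiv Thm. 2.6.1, p. 11 L23–28)] -/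
theorem exists_linearEquiv_of_free_rank_one (x : H) (hx0 : ∀ r : R, r • x = 0 → r = 0)
    (hgen : ∀ y : H, ∃ r : R, y = r • x) : ∃ e : H ≃ₗ[R] R, e x = 1 := by
  have hinj : Function.Injective (LinearMap.toSpanSingleton R H x) := by
    intro r s hrs
    rw [LinearMap.toSpanSingleton_apply, LinearMap.toSpanSingleton_apply] at hrs
    have h : (r - s) • x = 0 := by rw [sub_smul, hrs, sub_self]
    exact sub_eq_zero.mp (hx0 _ h)
  have hsurj : Function.Surjective (LinearMap.toSpanSingleton R H x) := fun y ↦ by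
    obtain ⟨r, rfl⟩ := hgen y
    exact ⟨r, LinearMap.toSpanSingleton_apply R H x r⟩
  refine ⟨(LinearEquiv.ofBijective _ ⟨hinj, hsurj⟩).symm, ?_⟩
  rw [LinearEquiv.symm_apply_eq, LinearEquiv.ofBijective_apply, LinearMap.toSpanSingleton_apply, one_smul]

/-- **`len_R (H ⧸ R∙κ₁) = len_R (R ⧸ (e κ₁))`** for an `R`-linear `e : H ≃ R`: the quotients are isomorphic
(`Submodule.Quotient.equiv` along `e`, which maps `R∙κ₁` onto the ideal `(e κ₁)`).
[cite: Howard2004HeegnerKolyvagin, Thm. 1.6.1 (arXiv Thm. 2.6.1, p. 11 L23–28)] -/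
theorem length_quotient_span_singleton_eq_of_linearEquiv (e : H ≃ₗ[R] R) (κ₁ : H) :
    Module.length R (H ⧸ R ∙ κ₁) = Module.length R (R ⧸ Ideal.span {e κ₁}) := by
  have hmap : (R ∙ κ₁).map (e : H →ₗ[R] R) = Ideal.span {e κ₁} := by
    rw [Submodule.map_span, Set.image_singleton]; rfl
  exact (Submodule.Quotient.equiv (R ∙ κ₁) (Ideal.span {e κ₁}) e hmap).length_eq

/-- **`len_R (H ⧸ R∙(r₁ • x)) = len_R (R ⧸ r₁R)`** for `H` free of rank one on `x` — the conversion between Howard's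
printed bound `len M ≤ len (H¹_F(K,T)/Rκ_1)`, `κ_1 = r₁ x`, and the tree's typed `len M ≤ len (R ⧸ span{r₁})`.
[cite: Howard2004HeegnerKolyvagin, Thm. 1.6.1 (arXiv Thm. 2.6.1, p. 11 L23–28)] -/
theorem length_quotient_span_smul_eq (x : H) (hx0 : ∀ r : R, r • x = 0 → r = 0)
    (hgen : ∀ y : H, ∃ r : R, y = r • x) (r₁ : R) :
    Module.length R (H ⧸ R ∙ (r₁ • x)) = Module.length R (R ⧸ Ideal.span {r₁}) := by
  obtain ⟨e, hex⟩ := exists_linearEquiv_of_free_rank_one x hx0 hgen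
  rw [length_quotient_span_singleton_eq_of_linearEquiv e, map_smul, hex, smul_eq_mul, mul_one]

end FreeRankOne

/-! ## §2 `𝒟 = Frac(R)/R` is divisible -/

section FracMod

variable {R : Type u} [CommRing R] [IsDomain R]

/-- **`Frac(R)/R` is divisible by every non-zero `r ∈ R`** (`R` a domain): `r • (q/r mod R) = q mod R`.
[cite: Howard2004HeegnerKolyvagin, §1.6 (𝒟 = Φ/R) and Thm. 1.6.1] -/
theorem exists_smul_eq_fracMod_of_ne_zero {r : R} (hr : r ≠ 0)
    (d : FractionRing R ⧸ (1 : Submodule R (FractionRing R))) :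
    ∃ d' : FractionRing R ⧸ (1 : Submodule R (FractionRing R)), r • d' = d := by
  induction d using Submodule.Quotient.induction_on with
  | H q =>
    have hr' : (algebraMap R (FractionRing R) r) ≠ 0 :=
      fun h ↦ hr (IsFractionRing.injective R (FractionRing R) (by rw [h, map_zero]))
    refine ⟨Submodule.Quotient.mk (q * (algebraMap R (FractionRing R) r)⁻¹), ?_⟩
    rw [← Submodule.Quotient.mk_smul, Algebra.smul_def, mul_comm, mul_assoc, inv_mul_cancel₀ hr', mul_one]

/-- `Frac(R)/R` is divisible by the non-zero-divisors of `R` (the shape `∀ r : R⁰, ∀ d, ∃ d', r • d' = d` of the tree's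
`nonempty_specWitness_of_howardShape`). [cite: Howard2004HeegnerKolyvagin, §1.6 (𝒟 = Φ/R) and Thm. 1.6.1] -/
theorem exists_smul_eq_fracMod_of_mem_nonZeroDivisors (r : R⁰)
    (d : FractionRing R ⧸ (1 : Submodule R (FractionRing R))) :
    ∃ d' : FractionRing R ⧸ (1 : Submodule R (FractionRing R)), (r : R) • d' = d :=
  exists_smul_eq_fracMod_of_ne_zero (nonZeroDivisors.coe_ne_zero r) d

/-- `Frac(R)/R` is divisible by every `n : ℕ` with `(n : R) ≠ 0` (the shape `∀ n ≠ 0, ∀ d, ∃ d', n • d' = d` of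
`nonempty_specWitness_of_howardShape_addEquiv` when `R` has characteristic `0`).
[cite: Howard2004HeegnerKolyvagin, §1.6 (𝒟 = Φ/R) and Thm. 1.6.1] -/
theorem exists_nsmul_eq_fracMod {n : ℕ} (hn : (n : R) ≠ 0)
    (d : FractionRing R ⧸ (1 : Submodule R (FractionRing R))) :
    ∃ d' : FractionRing R ⧸ (1 : Submodule R (FractionRing R)), n • d' = d := by
  obtain ⟨d', hd'⟩ := exists_smul_eq_fracMod_of_ne_zero hn d
  exact ⟨d', by rw [← Nat.cast_smul_eq_nsmul R, hd']⟩

end FracMod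

/-! ## §3 The Eisenstein quotients `S_m = Λ/(T^m + p)` -/

namespace IwasawaAlgebra

variable (p : ℕ) [hp : Fact p.Prime]

/-- **`Frac(S_m)/S_m` is divisible by every `n ≥ 1`** (`S_m = Λ/(T^m + p)`, `m ≥ 1`, a domain of characteristic `0`:
`(n : S_m) ≠ 0`, tree `IwasawaAlgebra.natCast_ne_zero`) — the divisibility input `hD` of the cell's witness constructor for
`D = 𝒟_{q_m}`. [cite: Howard2004HeegnerKolyvagin, §1.6 (𝒟 = Φ/R) and proof of Thm. 2.2.10 (𝔮 = T^m + p)] -/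
theorem exists_nsmul_eq_fracMod_quotient_X_pow_add_C {m : ℕ} (hm : 1 ≤ m) {n : ℕ} (hn : n ≠ 0)
    (d : letI := isDomain_quotient_X_pow_add_C p hm
      FractionRing (IwasawaAlgebra p ⧸
        Ideal.span {(PowerSeries.X ^ m + PowerSeries.C (p : ℤ_[p]) : IwasawaAlgebra p)}) ⧸
        (1 : Submodule (IwasawaAlgebra p ⧸
          Ideal.span {(PowerSeries.X ^ m + PowerSeries.C (p : ℤ_[p]) : IwasawaAlgebra p)})
          (FractionRing (IwasawaAlgebra p ⧸
            Ideal.span {(PowerSeries.X ^ m + PowerSeries.C (p : ℤ_[p]) : IwasawaAlgebra p)})))) :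
    letI := isDomain_quotient_X_pow_add_C p hm
    ∃ d' : FractionRing (IwasawaAlgebra p ⧸
        Ideal.span {(PowerSeries.X ^ m + PowerSeries.C (p : ℤ_[p]) : IwasawaAlgebra p)}) ⧸
        (1 : Submodule (IwasawaAlgebra p ⧸
          Ideal.span {(PowerSeries.X ^ m + PowerSeries.C (p : ℤ_[p]) : IwasawaAlgebra p)})
          (FractionRing (IwasawaAlgebra p ⧸
            Ideal.span {(PowerSeries.X ^ m + PowerSeries.C (p : ℤ_[p]) : IwasawaAlgebra p)}))),
      n • d' = d := by
  letI := isDomain_quotient_X_pow_add_C p hm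
  exact exists_nsmul_eq_fracMod (natCast_ne_zero p hm hn) d

end IwasawaAlgebra

end Literature.NumberTheory.EllipticCurves

end
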